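import Summits.BirchSwinnertonDyer.BirchSwinnertonDyer.Theses.ErratumRoadFive
import Summits.BirchSwinnertonDyer.Rank1Residual.X11b.RouteR1
import Summits.BirchSwinnertonDyer.Rank1Residual.X11b.BDPRouteRecord
import HarnessLib

/-!
# Route `ErratumRoadFive`, crux `OpenInputIMC` (item stmt-BirchSwinnertonDyer-19061): the planner's
# layer-2 split into THREE children, and its glue

Cell `bsd-stepL` (run/shared/lean/pub/bsd-stepL/), seat `bsd-stepL-imc-p1` (prover; D-0074 row A),
`--supports stmt-BirchSwinnertonDyer-19061`; companion of `ErratumRoadFiveOpenInputIMCReduction.lean`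
(p417457), which reduces the `R1Population ∩ Locus` part of the crux to the erratum currency
H2 = `R1.BDPValueCoreFrameOnTree` + H3 = `P2.IMCDivIntCoreFrameAtErratumData` and proves the two-way
splits. HONEST FRAMING: bookkeeping only; nothing here proves the crux or any child; BSD is not proved
by any of this; the named facts and the shapes H2, H3 are HYPOTHESES. THEOREMS ONLY (no definition,
no named fact, no `sorry`).

The three children (planner g23, HANDOFF trigger T-C; each a restriction of the crux
`OpenInputIMC = ∀ W p, P2OpenInputOnTreeAt W p`):
* child R     — `∀ W p, R1Population W p → ¬ p ∣ ∏_ℓ c_ℓ(E) → P2OpenInputOnTreeAt W p` (the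
  sub-locus the erratum road reaches; census 1 201 479 of the 2 267 348 X11b-shape pairs at
  `p ≥ 5`, `N < 5·10⁵`);
* child ram′  — `∀ W p, Ram W p → ¬ (R1Population W p ∧ ¬ p ∣ ∏c) → P2OpenInputOnTreeAt W p` (the
  (ram) sub-atoms outside: every `E[p]`-ramified multiplicative `q ≠ p` split ∕ no second ramified
  multiplicative prime ∕ `q = 2` only ∕ `E(ℚ_p)[p] ≠ 0` ∕ `p ∣ ∏c`);
* child ¬ram  — `∀ W p, ¬ Ram W p → P2OpenInputOnTreeAt W p` (the route's BC5 rung pair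
  `(6615d1, 5)` lives here).
This file: the glue `child R → child ram′ → child ¬ram → OpenInputIMC` and the equivalence (nothing is
lost). Child R is discharged modulo H2 ∧ H3 (and 11 published + 5 cited facts) by p417457's
`openInputIMC_r1Locus_of_coreFrames`, whose conclusion is child R VERBATIM; composing the two is a
one-line application left to the glue item's wrapper. Imports only the route file and the two X11b
statement files defining `R1Population` and `P2OpenInputOnTreeAt` (no dependence on p417457's module).

References: [Castella2018Erratum] Thm. 1.1 (iii)–(iv), (2.4), Thm. A′ (pp. 1, 4); [Castella2018] §5
(arXiv:1704.06608 p. 12); [Miller2011LMS] Def. 1.1.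
-/

set_option autoImplicit false

noncomputable section

open scoped Classical

open WeierstrassCurve Literature.NumberTheory.EllipticCurves
open Literature.NumberTheory.EllipticCurves.Rank1Residual
open Summit.BirchSwinnertonDyer.Rank1Residual Summit.BirchSwinnertonDyer.Rank1Residual.X11b
open Summit.BirchSwinnertonDyer.BirchSwinnertonDyer.Theses

namespace Summit.BirchSwinnertonDyer.BirchSwinnertonDyer.Theorems

/-- **Glue for the three-child split of item 19061.** `OpenInputIMC` follows from child R (its
`R1Population ∩ Locus` part), child ram′ (its part on the (ram) pairs OFF `R1Population ∩ Locus`) and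
child ¬ram (its ¬(ram) part). Bookkeeping only: case split on `Ram W p` and on
`R1Population W p ∧ p ∤ ∏c`. [folklore] -/
theorem openInputIMC_of_r1Locus_of_ramResidue_of_not_ram
    (hR : ∀ (W : WeierstrassCurve ℚ) [W.IsElliptic] [W.IsGloballyMinimal] (p : ℕ) [Fact p.Prime],
      R1Population W p → ¬ p ∣ W.tamagawaProduct → P2OpenInputOnTreeAt W p)
    (hRam : ∀ (W : WeierstrassCurve ℚ) [W.IsElliptic] [W.IsGloballyMinimal] (p : ℕ) [Fact p.Prime],
      Ram W p → ¬ (R1Population W p ∧ ¬ p ∣ W.tamagawaProduct) → P2OpenInputOnTreeAt W p)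
    (hOff : ∀ (W : WeierstrassCurve ℚ) [W.IsElliptic] [W.IsGloballyMinimal] (p : ℕ) [Fact p.Prime],
      ¬ Ram W p → P2OpenInputOnTreeAt W p) :
    ErratumRoadFive.OpenInputIMC := by
  unfold ErratumRoadFive.OpenInputIMC
  intro W _ _ p _
  by_cases hram : Ram W p
  · by_cases h : R1Population W p ∧ ¬ p ∣ W.tamagawaProduct
    · exact hR W p h.1 h.2
    · exact hRam W p hram h
  · exact hOff W p hram

/-- **The three-child split loses nothing**: `OpenInputIMC` is EQUIVALENT to the conjunction of
child R, child ram′ and child ¬ram (each child is a restriction of the crux). Bookkeeping only.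
[folklore] -/
theorem openInputIMC_iff_r1Locus_and_ramResidue_and_not_ram :
    ErratumRoadFive.OpenInputIMC ↔
      (∀ (W : WeierstrassCurve ℚ) [W.IsElliptic] [W.IsGloballyMinimal] (p : ℕ) [Fact p.Prime],
          R1Population W p → ¬ p ∣ W.tamagawaProduct → P2OpenInputOnTreeAt W p) ∧
        (∀ (W : WeierstrassCurve ℚ) [W.IsElliptic] [W.IsGloballyMinimal] (p : ℕ) [Fact p.Prime],
          Ram W p → ¬ (R1Population W p ∧ ¬ p ∣ W.tamagawaProduct) → P2OpenInputOnTreeAt W p) ∧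
        ∀ (W : WeierstrassCurve ℚ) [W.IsElliptic] [W.IsGloballyMinimal] (p : ℕ) [Fact p.Prime],
          ¬ Ram W p → P2OpenInputOnTreeAt W p := by
  refine ⟨fun h ↦ ⟨fun W _ _ p _ _ _ ↦ ?_, fun W _ _ p _ _ _ ↦ ?_, fun W _ _ p _ _ ↦ ?_⟩,
    fun h ↦ openInputIMC_of_r1Locus_of_ramResidue_of_not_ram h.1 h.2.1 h.2.2⟩
  all_goals
    unfold ErratumRoadFive.OpenInputIMC at h
    exact h W p


end Summit.BirchSwinnertonDyer.BirchSwinnertonDyer.Theorems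

end
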